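import Summits.AtomisticToContinuum.FouriersLaw.Theorems.HoelderEscapeProfileFibreCalculusStubPolynomialHorizonCone
import Summits.AtomisticToContinuum.FouriersLaw.Theorems.HoelderEscapeProfileFibreCalculusStubWeightedClusteringTransfer
import Summits.AtomisticToContinuum.FouriersLaw.Theorems.EmbeddedDrudeMourreMourreDissolutionGibbsMixing
import Literature.MathematicalPhysics.KineticTheory.InfiniteChainL2LocalityTools
import Literature.MathematicalPhysics.KineticTheory.InfiniteChainGibbsInvariance
import Literature.MathematicalPhysics.KineticTheory.InfiniteChainShiftInvariantUniqueness
import Literature.MathematicalPhysics.KineticTheory.InfiniteChainGoodSetSymmetries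
import HarnessLib

/-!
# Stub S1 `stub_covWindowMajorant` of line `Sketch` (canonical reduction), crux `CoercivePulse.PulseCalculus`
(item stmt-AtomisticToContinuum-15385)

For the pinned anharmonic chain `pinnedChain ω₂ lam β γ` (`ω₂, lam, β > 0`), its shift-invariant DLR state `μ`
at `T > 0`, a dynamics `D` with carrier `bmGood` and measurable flow maps, and a local observable `a` (sites
`−1, 0, 1`; in `L²(μ)` with `a⁴ ∈ L¹(μ)`; polynomially Lipschitz): there are `A, m` such that on every time window
`|t| ≤ τ` ONE non-negative majorant `F` of `x ↦ |Cov_μ(a, (a ∘ φ_t) ∘ τ_x)|` has `Σ_x (1+x²) F(x) ≤ A (1+τ)^m`.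

Proof (a re-export of the step `hwin` of the landed `Theorems/HoelderEscapeProfileFibreCalculus.lean`):
`μ` is superstable (`hasSuperstabilityEstimate_of_isShiftInvariant_pinnedChain`) and IS the exponentially
ρ-mixing transfer-operator state (`MourreDissolution.exists_gibbsState_mixing_pinnedChain` + DLR uniqueness among
shift-invariant states, `eq_of_isChainGibbsMeasure_of_isShiftInvariant_pinnedChain`); `D` preserves `μ`
(`preservesMeasure_of_carrier_eq_bmGood`). The polynomial-horizon weighted `L²` light cone
(`FibreCalculusSketch.stub_polynomialHorizonCone`) gives the locality rate `ε` of `a ∘ φ_t`, `|t| ≤ τ`, with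
`Σ_n (1+n)² ε_n ≤ A₀ (1+τ)^m`; the weighted clustering transfer (`FibreCalculusSketch.stub_weightedClusteringTransfer`)
turns it into a majorant `F` with `Σ_x (1+x²) F x ≤ B (1 + Σ_n (1+n)² ε_n) ≤ |B| (1 + A₀) (1+τ)^m`.
[cite: ButtaMarchioro2016, §3]
-/

noncomputable section

open MeasureTheory ProbabilityTheory Filter Topology Set Function

namespace Summit.AtomisticToContinuum.FouriersLaw.Theorems.PulseCalculus.CanonicalReduction

open Literature.MathematicalPhysics.KineticTheory.HeatConduction

/-- **S1 `stub_covWindowMajorant`, PROVED** (registered signature, verbatim). For the pinned chain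
(`ω₂, lam, β > 0`), the shift-invariant DLR state `μ` at `T > 0`, a dynamics `D` with carrier `bmGood` and
measurable flow maps, and a local observable `a` (measurable, depending on sites `−1,0,1`, in `L²(μ)` with
`a⁴ ∈ L¹(μ)`, poly-Lipschitz with constants `Ca, da`): there are `A, m` such that for every horizon `τ ≥ 0` one
non-negative majorant `F` with `Σ_x (1+x²)F(x) ≤ A(1+τ)^m` bounds `|Cov_μ(a, (a ∘ φ_t) ∘ τ_x)|` for all `|t| ≤ τ`
and all `x` (polynomial-horizon light cone ∘ weighted clustering transfer). [cite: ButtaMarchioro2016, §3] -/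
theorem stub_covWindowMajorant :
    ∀ ω₂ lam β γ : ℝ, 0 < ω₂ → 0 < lam → 0 < β → ∀ T : ℝ, 0 < T →
    ∀ μ : Measure ChainConfig, (pinnedChain ω₂ lam β γ).IsChainGibbsMeasure T μ → IsShiftInvariant μ →
    ∀ D : InfiniteChainDynamics (pinnedChain ω₂ lam β γ),
    D.carrier = (pinnedChain ω₂ lam β γ).bmGood → (∀ t : ℝ, Measurable (D.flow t)) →
    ∀ a : ChainConfig → ℝ, Measurable a → DependsOn a (Set.Icc (-1 : ℤ) 1) → MemLp a 2 μ →
    Integrable (fun σ => a σ ^ 4) μ →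
    ∀ (Ca : ℝ) (da : ℕ), 0 ≤ Ca →
    (∀ (σ σ' : ChainConfig) (R δ : ℝ), 1 ≤ R → 0 ≤ δ → δ ≤ 1 →
      (∀ i : ℤ, -1 ≤ i → i ≤ 1 → |(σ' i).1| ≤ R ∧ |(σ' i).2| ≤ R ∧
        |(σ i).1 - (σ' i).1| ≤ δ ∧ |(σ i).2 - (σ' i).2| ≤ δ) → |a σ - a σ'| ≤ Ca * R ^ da * δ) →
    ∃ (A : ℝ) (m : ℕ), ∀ τ : ℝ, 0 ≤ τ → ∃ F : ℤ → ℝ, (∀ x, 0 ≤ F x) ∧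
      Summable (fun x : ℤ => (1 + (x : ℝ) ^ 2) * F x) ∧
      (∑' x : ℤ, (1 + (x : ℝ) ^ 2) * F x) ≤ A * (1 + τ) ^ m ∧
      ∀ t : ℝ, |t| ≤ τ → ∀ x : ℤ, |cov[a, (a ∘ D.flow t) ∘ chainShift x; μ]| ≤ F x := by
  intro ω₂ lam β γ hω hl hβ T hT μ hG hSI D hcar hmeas a ham had ha2 ha4 Ca da hCa hLip
  /- §0 chain data: superstability, invariance of `μ` under `D` and under the shifts -/
  have hU1 : OscillatorChain.IsEvenPolyOfDegree (pinnedChain ω₂ lam β γ).U 2 :=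
    OscillatorChain.pinnedChain_isEvenPolyOfDegree_U β γ hω.le hl
  have hV1 : OscillatorChain.IsEvenPolyOfDegree (pinnedChain ω₂ lam β γ).V 2 :=
    OscillatorChain.pinnedChain_isEvenPolyOfDegree_V ω₂ lam γ hβ
  have hss : (pinnedChain ω₂ lam β γ).HasSuperstabilityEstimate μ :=
    OscillatorChain.hasSuperstabilityEstimate_of_isShiftInvariant_pinnedChain γ hω hl.le hβ.le hT hG hSI
  haveI : IsProbabilityMeasure μ := hss.1
  have hP' : D.PreservesMeasure μ :=
    OscillatorChain.preservesMeasure_of_carrier_eq_bmGood (by norm_num) (by norm_num) hU1 hV1 D hcar hmeas hG hss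
  have hτ : ∀ x : ℤ, MeasurePreserving (chainShift x) μ μ := hSI.measurePreserving_chainShift
  /- §1 W1: the polynomial-horizon weighted `L²` light cone of `a` -/
  obtain ⟨A0, m, hcone⟩ :=
    Summit.AtomisticToContinuum.FouriersLaw.Theorems.FibreCalculusSketch.stub_polynomialHorizonCone ω₂ lam β γ
      hω hl hβ T hT μ hG hSI D hcar hmeas a ham had ha2 ha4 Ca da hCa hLip
  /- §2 `μ` IS the ρ-mixing transfer-operator state (DLR uniqueness among shift-invariant states) -/
  obtain ⟨μ', hGμ', hSμ', -, -, C, mm, hmm, hmix⟩ :=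
    Summit.AtomisticToContinuum.FouriersLaw.Theorems.MourreDissolution.exists_gibbsState_mixing_pinnedChain
      ω₂ lam β γ hω hl.le hβ.le T hT
  have hμμ' : μ = μ' :=
    OscillatorChain.eq_of_isChainGibbsMeasure_of_isShiftInvariant_pinnedChain γ hω hl.le hβ.le hT hG hSI hGμ' hSμ'
  subst hμμ'
  /- §3 W2: the weighted clustering transfer for `a` (box `[-1, 1]`, margin `1`, level `‖a‖₂`) -/
  have had' : DependsOn a (Set.Icc (-((1 : ℕ) : ℤ)) (1 : ℕ)) := by simpa using had
  obtain ⟨B, hB⟩ :=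
    Summit.AtomisticToContinuum.FouriersLaw.Theorems.FibreCalculusSketch.stub_weightedClusteringTransfer μ
      inferInstance C mm hmm hmix hτ a 1 had' ham ha2 1 (Real.sqrt (∫ σ, a σ ^ 2 ∂μ)) (Real.sqrt_nonneg _)
  /- §4 the window majorant -/
  have hIcc : ∀ n : ℕ, Set.Icc (-((n + 1 : ℕ) : ℤ)) ((n + 1 : ℕ) : ℤ) = Set.Icc (-(n : ℤ) - 1) ((n : ℤ) + 1) := by
    intro n; push_cast; ring_nf
  refine ⟨|B| * (1 + A0), m, fun τ hτ0 => ?_⟩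
  obtain ⟨ε, hε0, hεs, hεb, happ⟩ := hcone τ hτ0
  obtain ⟨F, hFs, hFb, hcov⟩ := hB ε hε0 hεs
  have hbound : ∀ t : ℝ, |t| ≤ τ → ∀ x : ℤ, |cov[a, (a ∘ D.flow t) ∘ chainShift x; μ]| ≤ F x := by
    intro t ht x
    refine hcov (a ∘ D.flow t) (ham.comp (hmeas t)) (ha2.comp_measurePreserving (hP'.2 t)) ?_ ?_ x
    · exact Real.sqrt_le_sqrt (integral_sq_comp_eq' (hP'.2 t) ham).le
    · intro n
      obtain ⟨g, hgd, hgm, hg2, hge⟩ := happ t ht n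
      refine ⟨g, ?_, hgm, hg2, hge⟩
      rw [hIcc n]
      exact hgd
  have hF0 : ∀ x, 0 ≤ F x := fun x => (abs_nonneg _).trans (hbound 0 (by rw [abs_zero]; exact hτ0) x)
  have hE0 : 0 ≤ ∑' n : ℕ, (1 + (n : ℝ)) ^ 2 * ε n := tsum_nonneg fun n => mul_nonneg (by positivity) (hε0 n)
  have hA0 : 0 ≤ A0 * (1 + τ) ^ m := hE0.trans hεb
  refine ⟨F, hF0, hFs, hFb.trans ?_, hbound⟩
  have h1τ : (1 : ℝ) ≤ (1 + τ) ^ m := one_le_pow₀ (by linarith)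
  calc B * (1 + ∑' n : ℕ, (1 + (n : ℝ)) ^ 2 * ε n)
      ≤ |B| * (1 + ∑' n : ℕ, (1 + (n : ℝ)) ^ 2 * ε n) :=
        mul_le_mul_of_nonneg_right (le_abs_self B) (by linarith)
    _ ≤ |B| * (1 + A0 * (1 + τ) ^ m) := mul_le_mul_of_nonneg_left (by linarith) (abs_nonneg B)
    _ ≤ |B| * ((1 + A0) * (1 + τ) ^ m) := by
        refine mul_le_mul_of_nonneg_left ?_ (abs_nonneg B)
        nlinarith
    _ = |B| * (1 + A0) * (1 + τ) ^ m := by ring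

end Summit.AtomisticToContinuum.FouriersLaw.Theorems.PulseCalculus.CanonicalReduction

end
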